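import Summits.AtomisticToContinuum.Crystallization.Theses.IsometryAtoms
import Summits.AtomisticToContinuum.Crystallization.Theorems.PalmUnimodularRigidityBenjaminiSchrammLimitEnergy
import Summits.AtomisticToContinuum.Crystallization.Theorems.PalmUnimodularRigidityBenjaminiSchrammLimitEmbedding
import Summits.AtomisticToContinuum.Crystallization.Theorems.LayeredLawsSelectHcp.Negative.FccModel
import Mathlib.MeasureTheory.Constructions.Polish.Basic

/-!
# Negative knowledge for crux `MinimisingLawsHaveAtoms` (stmt-AtomisticToContinuum-15776), II:
# diffuse point-stationary hard-core laws — the minimising hypothesis and the normalisation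
# `P(univ) = 1` are load-bearing

Standing crux disprover `cdisprove-stmt-AtomisticToContinuum-15776`,
`--supports stmt-AtomisticToContinuum-15776`.  A counterexample to the crux
`IsometryAtoms.MinimisingLawsHaveAtoms` must be a law on `Measure ℝ³` charging NO rooted isometry
class `rootedClass Y = {count|A(Y − q)}` — in particular a law without atoms, i.e. a continuum
mixture of pairwise non-isometric configurations (Part I, `pos_rootedClass_of_dirac`).  This file
builds the machine that produces such laws and certifies everything the crux asks of them except the
energy value:

* §1 `familyLaw f` — the law of `count|f(t)`, `t` uniform on `[0, 1]`, for a CONTINUOUS INJECTIVE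
  family `f : ℝ → RootedHardCoreConfig ℝ³ δ`.  Along the landed measurable embedding
  `S ↦ count|S` (`BenjaminiSchrammLimit.measurableEmbedding_toMeasure`, item 9230's helper) composed
  with Lusin–Souslin (`Continuous.measurableEmbedding`), `familyLaw f` is a probability law, a.s.
  `δ`-hard-core, its integrals and outer measures are computed parameter-wise, it is
  point-stationary as soon as each `count|f(t)` satisfies the Mecke identity pointwise
  (`isPointStationaryLaw_familyLaw`), and it is ISOMETRY-DIFFUSE (`familyLaw_rootedClass`:
  `P(rootedClass Y) = 0` for EVERY `Y`) as soon as some isometry invariant separates the members of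
  the family.
* §2 `mecke_count_restrict_addSubgroup` — the counting measure of a countable additive subgroup of
  `ℝ³` satisfies the Mecke identity POINTWISE, for every (even non-measurable) test function.
The instance (Part III, `RandomSpacingChain.lean`): the random-spacing chain `t ↦ ℤ·(1 + eᵗ/3)e₀`
gives `minimisingLawsHaveAtoms_false_without_minimising` (without the energy hypothesis the crux is
false: a point-stationary `1`-hard-core probability law charging no rooted class) and
`minimisingLawsHaveAtoms_false_without_probability` (the normalisation `P(univ) = 1` is
load-bearing).  Moral for the prover: hard core + Mecke identity + probability leave room for
isometry-diffuse laws; only the exact energy value `e*` (Part I: minimising ⇔ `= e*`) can force an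
atom.  All `[folklore]`.
-/

noncomputable section

namespace Summit.AtomisticToContinuum.Crystallization.Theorems.MinimisingLawsHaveAtoms.Negative.DiffuseFamilies

open MeasureTheory Set Filter Metric Function
open scoped ENNReal Topology
open Literature.MathematicalPhysics.StatisticalMechanics Literature.Probability.Process
open Literature.Probability.Process.LocalConfig
open Summit.AtomisticToContinuum.Crystallization.Theses.IsometryAtoms (MinimisingLawsHaveAtoms)
open Summit.AtomisticToContinuum.Crystallization.Theorems.ChargedEnergyGapNegative (eStar eStar_le)
open Summit.AtomisticToContinuum.Crystallization.Theorems.BenjaminiSchrammLimit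
  (measurableEmbedding_toMeasure integrable_lennardJones_toMeasure
    continuous_integral_lennardJones_toMeasure)
open Summit.AtomisticToContinuum.Crystallization.Theorems.LayeredLawsSelectHcp.Negative.DiracLaws
  (map_count_restrict_eq)
open Summit.AtomisticToContinuum.Crystallization.Theorems.LayeredLawsSelectHcp.Negative.FccModel
  (set_eq_of_count_restrict_eq)

/-- Euclidean `3`-space. [folklore] -/
local notation "E3" => EuclideanSpace ℝ (Fin 3)

/-! ## §0 Rooted isometry classes and isometry invariants -/

/-- The rooted isometry class of `Y` (the event of the crux). [folklore] -/
def rootedClass (Y : Set E3) : Set (Measure E3) :=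
  {μ | ∃ A : E3 →ₗᵢ[ℝ] E3, ∃ q ∈ Y,
    μ = (Measure.count : Measure E3).restrict ((fun s => A (s - q)) '' Y)}

/-- The pattern map `s ↦ A (s − q)` is an isometry of `ℝ³`. [folklore] -/
theorem isometry_pattern (A : E3 →ₗᵢ[ℝ] E3) (q : E3) : Isometry fun s : E3 => A (s - q) :=
  Isometry.of_dist_eq fun x y => by rw [A.dist_map, dist_sub_right]

/-- A counting measure in a rooted class has an isometric copy of `Y` as carrier. [folklore] -/
theorem exists_eq_image_of_mem_rootedClass {Y S : Set E3}
    (h : (Measure.count : Measure E3).restrict S ∈ rootedClass Y) :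
    ∃ φ : E3 → E3, Isometry φ ∧ S = φ '' Y := by
  obtain ⟨A, q, -, hS⟩ := h
  exact ⟨fun s => A (s - q), isometry_pattern A q, set_eq_of_count_restrict_eq hS⟩

/-- **The gap invariant**: the supremum of the admissible hard cores of a point set,
`gapSup X = sSup {s | X is s-separated}` (for an `a`-separated set attaining `a` it equals `a`).
[folklore] -/
def gapSup (X : Set E3) : ℝ :=
  sSup {s : ℝ | ∀ x ∈ X, ∀ y ∈ X, x ≠ y → s ≤ dist x y}

/-- `gapSup` is an isometry invariant. [folklore] -/
theorem gapSup_image {φ : E3 → E3} (hφ : Isometry φ) (X : Set E3) : gapSup (φ '' X) = gapSup X := by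
  unfold gapSup
  congr 1
  ext s
  simp only [mem_setOf_eq]
  constructor
  · intro h x hx y hy hxy
    have := h (φ x) (mem_image_of_mem φ hx) (φ y) (mem_image_of_mem φ hy)
      (fun e => hxy (hφ.injective e))
    rwa [hφ.dist_eq] at this
  · rintro h _ ⟨x, hx, rfl⟩ _ ⟨y, hy, rfl⟩ hxy
    rw [hφ.dist_eq]
    exact h x hx y hy fun e => hxy (by rw [e])

/-- If `X` is `a`-separated and `a` is attained, `gapSup X = a`. [folklore] -/
theorem gapSup_eq {X : Set E3} {a : ℝ} (hsep : ∀ x ∈ X, ∀ y ∈ X, x ≠ y → a ≤ dist x y)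
    {x₀ y₀ : E3} (hx₀ : x₀ ∈ X) (hy₀ : y₀ ∈ X) (hne : x₀ ≠ y₀) (hd : dist x₀ y₀ = a) :
    gapSup X = a := by
  have hset : {s : ℝ | ∀ x ∈ X, ∀ y ∈ X, x ≠ y → s ≤ dist x y} = Iic a := by
    ext s
    simp only [mem_setOf_eq, mem_Iic]
    exact ⟨fun h => hd ▸ h x₀ hx₀ y₀ hy₀ hne, fun h x hx y hy hxy => h.trans (hsep x hx y hy hxy)⟩
  rw [gapSup, hset, csSup_Iic]

/-! ## §1 Laws of continuous injective families of rooted hard-core configurations -/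

section Family

variable {δ : ℝ} [Fact (0 < δ)]

/-- The configuration-as-measure of the member `f t`. [folklore] -/
abbrev cfgMeasure (f : ℝ → RootedHardCoreConfig E3 δ) (t : ℝ) : Measure E3 :=
  ((f t).1 : LocalConfig E3).toMeasure

/-- The uniform probability on `[0, 1]`. [folklore] -/
def unitLaw : Measure ℝ := (volume : Measure ℝ).restrict (Icc 0 1)

/-- `unitLaw` is a probability measure. [folklore] -/
instance : IsProbabilityMeasure unitLaw :=
  ⟨by rw [unitLaw, Measure.restrict_apply_univ, Real.volume_Icc]; simp⟩

/-- `unitLaw` has no atoms. [folklore] -/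
instance : NullSingletonClass unitLaw := by
  unfold unitLaw; infer_instance

/-- **The law of a family**: push `t` uniform on `[0,1]` forward to `count|f(t)`. [folklore] -/
def familyLaw (f : ℝ → RootedHardCoreConfig E3 δ) : Measure (Measure E3) :=
  unitLaw.map (cfgMeasure f)

variable {f : ℝ → RootedHardCoreConfig E3 δ}

/-- For a continuous injective family, `t ↦ count|f(t)` is a measurable embedding (Lusin–Souslin on
`ℝ → RootedHardCoreConfig`, composed with the landed embedding `S ↦ count|S`). [folklore] -/
theorem measurableEmbedding_cfgMeasure (hf : Continuous f) (hinj : Injective f) :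
    MeasurableEmbedding (cfgMeasure f) :=
  (measurableEmbedding_toMeasure E3 (δ := δ)).comp (hf.measurableEmbedding hinj)

/-- The law of a continuous injective family is a probability law. [folklore] -/
theorem isProbabilityMeasure_familyLaw (hf : Continuous f) (hinj : Injective f) :
    IsProbabilityMeasure (familyLaw f) :=
  Measure.isProbabilityMeasure_map (measurableEmbedding_cfgMeasure hf hinj).measurable.aemeasurable

/-- Outer measures under the law of a family are computed parameter-wise. [folklore] -/
theorem familyLaw_apply (hf : Continuous f) (hinj : Injective f) (s : Set (Measure E3)) :
    familyLaw f s = unitLaw (cfgMeasure f ⁻¹' s) :=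
  (measurableEmbedding_cfgMeasure hf hinj).map_apply _ s

/-- The law of a family is a.s. `δ`-hard-core. [folklore] -/
theorem ae_isRootedHardCore_familyLaw (hf : Continuous f) (hinj : Injective f) :
    ∀ᵐ μ ∂(familyLaw f), IsRootedHardCore δ μ :=
  (measurableEmbedding_cfgMeasure hf hinj).ae_map_iff.2
    (Eventually.of_forall fun t => (isRootedHardCore_toMeasure_iff δ _).2 (f t).2)

/-- Bochner integrals under the law of a family are parameter integrals. [folklore] -/
theorem integral_familyLaw (hf : Continuous f) (hinj : Injective f) (F : Measure E3 → ℝ) :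
    ∫ μ, F μ ∂(familyLaw f) = ∫ t, F (cfgMeasure f t) ∂unitLaw :=
  (measurableEmbedding_cfgMeasure hf hinj).integral_map F

/-- **Point-stationarity from the pointwise Mecke identity**: if every member `count|f(t)`
satisfies the Mecke identity for every test function, the law of the family is point-stationary
(no Giry-measurability of the inner integrals is needed along a measurable embedding). [folklore] -/
theorem isPointStationaryLaw_familyLaw (hf : Continuous f) (hinj : Injective f)
    (hMecke : ∀ t, ∀ g : Measure E3 → E3 → ℝ≥0∞,
      ∫⁻ y, g (cfgMeasure f t) y ∂(cfgMeasure f t) =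
        ∫⁻ y, g ((cfgMeasure f t).map fun z => z - y) (-y) ∂(cfgMeasure f t)) :
    IsPointStationaryLaw (familyLaw f) := by
  intro g _
  unfold familyLaw
  rw [(measurableEmbedding_cfgMeasure hf hinj).lintegral_map,
    (measurableEmbedding_cfgMeasure hf hinj).lintegral_map]
  exact lintegral_congr fun t => hMecke t g

/-- **Isometry-diffuseness from a separating invariant**: if an isometry invariant `ι` of point sets
takes pairwise different values along the family, the law of the family charges NO rooted isometry
class — `P(rootedClass Y) = 0` for every `Y ⊆ ℝ³` (at most one parameter can produce a copy of `Y`,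
and `unitLaw` has no atoms). [folklore] -/
theorem familyLaw_rootedClass {β : Type*} (ι : Set E3 → β)
    (hι : ∀ φ : E3 → E3, Isometry φ → ∀ X : Set E3, ι (φ '' X) = ι X) (hf : Continuous f)
    (hsep : Injective fun t => ι (((f t).1 : LocalConfig E3) : Set E3)) (Y : Set E3) :
    familyLaw f (rootedClass Y) = 0 := by
  have hinj : Injective f := fun t₁ t₂ h => hsep (by simp only [h])
  rw [familyLaw_apply hf hinj]
  refine Set.Subsingleton.measure_zero ?_ _
  intro t₁ ht₁ t₂ ht₂
  apply hsep
  obtain ⟨φ₁, hφ₁, e₁⟩ := exists_eq_image_of_mem_rootedClass ht₁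
  obtain ⟨φ₂, hφ₂, e₂⟩ := exists_eq_image_of_mem_rootedClass ht₂
  change ι (((f t₁).1 : LocalConfig E3) : Set E3) = ι (((f t₂).1 : LocalConfig E3) : Set E3)
  rw [e₁, e₂, hι _ hφ₁, hι _ hφ₂]

end Family

/-! ## §2 The Mecke identity holds pointwise at counting measures of additive subgroups -/

/-- **Counting measures of countable additive subgroups satisfy the Mecke identity pointwise**, for
every test function: `θ_y count|L = count|L` for `y ∈ L` and `count|L` is invariant under `y ↦ −y`
(the computation of `DiracLaws.pointStationary_dirac_addSubgroup`, freed from the Dirac law).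
[folklore] -/
theorem mecke_count_restrict_addSubgroup (L : AddSubgroup E3) (hL : (L : Set E3).Countable)
    (g : Measure E3 → E3 → ℝ≥0∞) :
    ∫⁻ y, g ((Measure.count : Measure E3).restrict (L : Set E3)) y
        ∂((Measure.count : Measure E3).restrict (L : Set E3)) =
      ∫⁻ y, g (((Measure.count : Measure E3).restrict (L : Set E3)).map fun z => z - y) (-y)
        ∂((Measure.count : Measure E3).restrict (L : Set E3)) := by
  set ν := (Measure.count : Measure E3).restrict (L : Set E3) with hνdef
  have hLm : MeasurableSet (L : Set E3) := hL.measurableSet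
  have h1 : ∀ y ∈ (L : Set E3), Measure.map (fun z => z - y) ν = ν := fun y hy => by
    have : (fun z : E3 => z - y) = ⇑(MeasurableEquiv.subRight y) := rfl
    rw [this]
    refine map_count_restrict_eq _ hL ?_
    ext z
    simp only [Set.mem_preimage, SetLike.mem_coe]
    change z - y ∈ L ↔ z ∈ L
    exact ⟨fun h => by simpa using L.add_mem h hy, fun h => L.sub_mem h hy⟩
  have h2 : (fun y => g (Measure.map (fun z => z - y) ν) (-y)) =ᵐ[ν] fun y => g ν (-y) := by
    filter_upwards [ae_restrict_mem hLm] with y hy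
    rw [h1 y hy]
  rw [lintegral_congr_ae h2]
  have h3 : Measure.map (MeasurableEquiv.neg E3) ν = ν := by
    refine map_count_restrict_eq _ hL ?_
    ext z
    simp only [Set.mem_preimage, SetLike.mem_coe]
    change -z ∈ L ↔ z ∈ L
    exact neg_mem_iff
  calc ∫⁻ y, g ν y ∂ν = ∫⁻ y, g ν y ∂(Measure.map (MeasurableEquiv.neg E3) ν) := by rw [h3]
    _ = ∫⁻ y, g ν ((MeasurableEquiv.neg E3) y) ∂ν := lintegral_map_equiv _ _
    _ = ∫⁻ y, g ν (-y) ∂ν := rfl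

end Summit.AtomisticToContinuum.Crystallization.Theorems.MinimisingLawsHaveAtoms.Negative.DiffuseFamilies

end
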